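import Summits.HodgeConjecture.HodgeConjecture.Theorems.F0LD1ArchTypeAwayKcOfInvariant
import HarnessLib

-- As in the lineage (★ `F0LD2ArchTypeAwayCore`): large statements over the theta-kernel datum; elaborate sequentially.
set_option Elab.async false
/-!
# Crux `HLiu418`, ROAD O brick (β-away), PART 2: THE TWO VANISHING CORES for a `K_c(w₁)`-FIXED `P` — the projected theta functional of a discrete `P` of `U(H)`
# fixed vector by vector by the compact archimedean factor `K_c(w₁)` VANISHES on pure tensors when the archimedean exponent at a definite place `w₀ ≠ w₁` is wrong
# ([Liu2021, App. D Lem. D.2 (1)]; ★ `F0LD2ArchTypeAwayCore.…_eq_zero_of_pos₂ ∕ _of_neg₂` re-threaded over the hypothesis `hKc`)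

Cell hodgecm-mathlib (D-0151), FLOOR 0; crux item `HLiu418` = stmt-HodgeConjecture-24832 (route `HCCMUnconditional`); ROAD O («orthogonal copy»; chair LD1-plan (g3)
HANDS v4 2026-09-02T13:06:19Z; critic LD-ref1 (g3) BOX ROAD-O #5 13:06:32Z): brick (β-away), seat LD1-p02 (g6).  THEOREMS ONLY (no `def`, no instance, no
notation, no named fact, no `sorry`); `--supports stmt-HodgeConjecture-24832`.  HC_CM is proved only modulo the 7 printed citations (2 remaining: hLiu418 =
stmt-HodgeConjecture-24832, h413 = stmt-HodgeConjecture-24833) until rung 0 closes; this file discharges nothing printed — it is part 2 of the analytic core of the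
(β-away) head `Theorems/F0LD1ArchTypeAwayOfInvariant`; part 1 (doors, `U(V_{w₀})`-invariance, box covariance) = ★ `Theorems/F0LD1ArchTypeAwayKcOfInvariant`.

WHAT.  The two theorems below are ★ `F0LD2ArchTypeAwayCore.starProjection_toLp_lineThetaLift_tmul_eq_zero_of_pos₂ ∕ _of_neg₂` TOKEN FOR TOKEN — statements and
proofs — except that the hol-test-vector binders `(𝔣 : ConeFrame L H w₁) {fh} (hfh) (hj) (hjmem) (hjne)` are replaced by the single hypothesis
  `hKc : ∀ k ∈ K_c(w₁), ∀ v ∈ P.space, R(k) v = v`   («`P` is fixed by `K_c(w₁) = (ker archAt w₁).map archToAdelic` vector by vector»),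
and the one internal call (★ :241 ∕ :365, the box covariance `hcov₁`) is re-pointed to part 1's `starProjection_toLp_lineThetaLift_tmul_of_box_of_fixed`.  Why this is
faithful: the ★ proofs read the hol data only through that call (tree-read; LD-ref1 BOX #5).  Assembly (unchanged from ★): ★ T3 `F0LD2ThetaTensorCLM.exists_clm_comp_toLp_lineThetaLift_tmul`
CLM; ★ β-I± `exists_sectionD_archKPlace_apply_of_pos ∕ _of_neg` + `hβII` ⇒ the box law on the Hermite basis with `c = vac`; ★ (G) `etaD_mul_vac_archKPlace_of_pos ∕ _of_neg`;
★ S2 `det_eq_star_pow_of_entries ∕ det_eq_pow_of_entries`; `hS1`; ★ δ `eq_zero_of_forall_unitaryOpPi_placeBlock_mulSingle_hermitePi` (`Nontrivial (Fin n′)` from `n′ = 2`).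

References: [Liu2021] Y. Liu, Camb. J. Math. 9 (2021), proof of Prop. 4.13 Case 1 (l. 2137–2141, p. 48), App. D Lem. D.2 (1) (p. 127, l. 5283);
[GelbartRogawski1991] Invent. Math. 105 (1991), §3.1 Prop. 3.1.1 p. 455; [KonnoKonno2007] Kyushu J. Math. 61 (2007), Thm. 5.4, Lemma 5.2; [Folland1989]
Prop. (4.39), (4.76); [BorelJacquet1979] PSPM 33.1 (1979), §4.1, §4.6.
-/

set_option autoImplicit false
-- the mandated namespace has the single-problem summit's repeated segment (`HodgeConjecture.HodgeConjecture`)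
set_option linter.dupNamespace false

noncomputable section
open NumberField NumberField.InfinitePlace MeasureTheory IsDedekindDomain
open scoped Matrix ComplexOrder ENNReal TensorProduct SchwartzMap Kronecker Classical


namespace Summit.HodgeConjecture.HodgeConjecture.Cruxes.HLiu418.F0LD1ArchTypeAwayCoreOfInvariant

open _root_.MeasureTheory
open Literature.NumberTheory.Automorphic Literature.NumberTheory.Automorphic.UnitaryGroup
open Literature.NumberTheory.Automorphic.UnitaryGroup.CotangentForms
open Literature.NumberTheory.Automorphic.UnitaryCurveForms
open Literature.NumberTheory.Automorphic.IdeleClassGroup Literature.NumberTheory.Automorphic.Liu2021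
open Literature.NumberTheory.Automorphic.Liu2021.Def411WeilCarriers Literature.NumberTheory.Automorphic.Liu2021.Def411WeilCarriersDoubling
open Literature.NumberTheory.GelbartRogawski1991 Literature.NumberTheory.GelbartRogawski1991.UnitaryDualPair Literature.NumberTheory.GelbartRogawski1991.GRConstruction
open Literature.NumberTheory.Weil1964 Literature.RepresentationTheory.Liu2021
open Literature.RepresentationTheory.HeisenbergGroup Literature.Analysis.SegalBargmann Literature.RepresentationTheory.KonnoKonno2007
open Literature.RepresentationTheory.CompactGroups
open F0LD1ArchTypeAwayKcOfInvariant

section Core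
variable (L : Type) [Field L] [NumberField L] [IsCMField L] (H : Matrix (Fin 2) (Fin 2) L)
  {n' : ℕ} (e₁ : Fin 2 × Fin 1 ≃ Fin n') (dV : Fin 2 → L) (hdV : ∀ i, IsCMField.complexConj L (dV i) = dV i)
  (hdV0 : ∀ i, dV i ≠ 0) (t : L) (ht : t ≠ 0) (g : GL (Fin 2) L)
  (hg : formCongr ((IsCMField.complexConj L : L ≃ₐ[↥(maximalRealSubfield L)] L) : L →+* L) g (t • H) = Matrix.diagonal dV)
  (ιA : (adelicGroupData (↥(maximalRealSubfield L)) L (IsCMField.complexConj L) 2 H).Adelic →* ↥(UnitaryGroup.adelic (↥(maximalRealSubfield L)) L (IsCMField.complexConj L) 2 (Matrix.diagonal dV)))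
  (hιA : Continuous ιA ∧ ∀ ⦃γ : (adelicGroupData (↥(maximalRealSubfield L)) L (IsCMField.complexConj L) 2 H).Adelic⦄,
    γ ∈ (UnitaryGroup.toAdelic (↥(maximalRealSubfield L)) L (IsCMField.complexConj L) 2 H).range →
      ιA γ ∈ (UnitaryGroup.toAdelic (↥(maximalRealSubfield L)) L (IsCMField.complexConj L) 2 (Matrix.diagonal dV)).range)
  (hpin : ∀ k, ((ιA k : ↥(UnitaryGroup.adelic (↥(maximalRealSubfield L)) L (IsCMField.complexConj L) 2 (Matrix.diagonal dV))) :
      GL (Fin 2) (AdeleRing (𝓞 L) L)) =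
    (toAdeleGL L g)⁻¹ * adelicVal (↥(maximalRealSubfield L)) L (IsCMField.complexConj L) 2 H k * toAdeleGL L g)
  (μ : Literature.NumberTheory.Automorphic.IdeleClassGroup L →ₜ* Circle) (hμ : IsConjugateSymplectic L μ) (a : (↥(maximalRealSubfield L))ˣ)
  (hρ : HasThetaMajorants fun
      (p : ↥(UnitaryGroup.adelic (↥(maximalRealSubfield L)) L (IsCMField.complexConj L) 2 (Matrix.diagonal dV)) × ↥(UnitaryGroup.adelic (↥(maximalRealSubfield L)) L (IsCMField.complexConj L) 1 (JW (↥(maximalRealSubfield L)) L a))) (Φ : piSchwartzBruhat (↥(maximalRealSubfield L)) (Fin n')) =>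
        pairRep (↥(maximalRealSubfield L)) L (IsCMField.complexConj L) 2 1 e₁ (Matrix.diagonal dV) (JW (↥(maximalRealSubfield L)) L a)
          (chiSplittingLine L e₁ dV hdV hdV0 (toHeckeCharacter L μ) (isUnitary_toHeckeCharacter L μ)
            ((isOscillatorChar_toHeckeCharacter_iff μ).mpr hμ) (TW (↥(maximalRealSubfield L)) a)
            (isUnit_det_TW (↥(maximalRealSubfield L)) a) (JW (↥(maximalRealSubfield L)) L a) (JW_eq (↥(maximalRealSubfield L)) L a))
          p Φ)
  [CompactSpace (↥(UnitaryGroup.adelic (↥(maximalRealSubfield L)) L (IsCMField.complexConj L) 2 (Matrix.diagonal dV)) ⧸ (UnitaryGroup.toAdelic (↥(maximalRealSubfield L)) L (IsCMField.complexConj L) 2 (Matrix.diagonal dV)).range)] [MeasurableSpace (↥(UnitaryGroup.adelic (↥(maximalRealSubfield L)) L (IsCMField.complexConj L) 1 (JW (↥(maximalRealSubfield L)) L a)) ⧸ (UnitaryGroup.toAdelic (↥(maximalRealSubfield L)) L (IsCMField.complexConj L) 1 (JW (↥(maximalRealSubfield L)) L a)).range)] [BorelSpace (↥(UnitaryGroup.adelic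 (↥(maximalRealSubfield L)) L (IsCMField.complexConj L) 1 (JW (↥(maximalRealSubfield L)) L a)) ⧸ (UnitaryGroup.toAdelic (↥(maximalRealSubfield L)) L (IsCMField.complexConj L) 1 (JW (↥(maximalRealSubfield L)) L a)).range)] (μW : Measure (↥(UnitaryGroup.adelic (↥(maximalRealSubfield L)) L (IsCMField.complexConj L) 1 (JW (↥(maximalRealSubfield L)) L a)) ⧸ (UnitaryGroup.toAdelic (↥(maximalRealSubfield L)) L (IsCMField.complexConj L) 1 (JW (↥(maximalRealSubfield L)) L a)).range)) [IsFiniteMeasure μW]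
  (f : C((↥(UnitaryGroup.adelic (↥(maximalRealSubfield L)) L (IsCMField.complexConj L) 1 (JW (↥(maximalRealSubfield L)) L a)) ⧸ (UnitaryGroup.toAdelic (↥(maximalRealSubfield L)) L (IsCMField.complexConj L) 1 (JW (↥(maximalRealSubfield L)) L a)).range), ℂ))
  (w₁ : {w : InfinitePlace L // w.IsComplex})
  {μA : Measure (adelicGroupData (↥(maximalRealSubfield L)) L (IsCMField.complexConj L) 2 H).automorphicQuotient}
  [(adelicGroupData (↥(maximalRealSubfield L)) L (IsCMField.complexConj L) 2 H).IsAutomorphicMeasure μA]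
  [CompactSpace (adelicGroupData (↥(maximalRealSubfield L)) L (IsCMField.complexConj L) 2 H).automorphicQuotient]
  (P : DiscreteAutomorphicRep (adelicGroupData (↥(maximalRealSubfield L)) L (IsCMField.complexConj L) 2 H) μA)
  (hKc : ∀ k ∈ ((archAt (↥(maximalRealSubfield L)) L (IsCMField.complexConj L) 2 H w₁ (UnitaryGroup.complexConj_smul_infinitePlace L w₁.1)
      (IsCMField.complexConj_ne_one L)).ker).map (archToAdelic (↥(maximalRealSubfield L)) L (IsCMField.complexConj L) 2 H),
    ∀ v ∈ P.space, (adelicGroupData (↥(maximalRealSubfield L)) L (IsCMField.complexConj L) 2 H).rightRegular μA k v = v)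
  (v₀ : {v : InfinitePlace (↥(maximalRealSubfield L)) // v.IsReal})

include ht hg hpin hKc in
set_option maxHeartbeats 1600000 in -- (as ★ n = 3: the telescope of ★ α ∕ ★ T3 is large; the rewrites are cheap but numerous)
/-- **THE PROJECTED THETA FUNCTIONAL VANISHES ON PURE TENSORS WHEN THE ARCHIMEDEAN EXPONENT IS WRONG, pair form POSITIVE at `v₀`** (the `hKc` twin of ★ `…_eq_zero_of_pos₂`, proof verbatim; trailing binders `(φ) (Φf)` here, ★ has `(Φf) (φ)`)
(`w₀ = cmPlaceOver L v₀ ≠ w(ι)`, `(τ_{w₀}+1)/2 ≠ 0`; modulo `hS1`, `hβII` — see the module docstring).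
[cite: Liu2021, proof of Prop. 4.13 Case 1 (l. 2137–2141, p. 48); App. D Lem. D.2 (1)] [cite: KonnoKonno2007, Thm. 5.4, Lemma 5.2] [cite: Folland1989, Prop. (4.76)] -/
theorem starProjection_toLp_lineThetaLift_tmul_eq_zero_of_pos_of_fixed (hw₀ : cmPlaceOver L v₀ ≠ w₁)
    {τ : InfinitePlace L → ℤ} (hτ : (toHeckeCharacter L μ).HasUnitaryArchType τ 0) (hodd : ∀ w, Odd (τ w))
    (hpos : ∀ k : Fin n', 0 < signVec (cmPlaceOver L) (cmGramEntry L e₁ dV hdV (lineW L (TW (↥(maximalRealSubfield L)) a))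
      (complexConj_lineW L (TW (↥(maximalRealSubfield L)) a))) (imagUnit L) v₀ k)
    (hm : (τ (cmPlaceOver L v₀).1 + 1) / 2 ≠ 0)
    (hS1 : ∀ A : Matrix.unitaryGroup (Fin n') ℂ, ∃ u : UnitaryGroup.archLocal L 2 (Matrix.diagonal dV) (cmPlaceOver L v₀),
      ∀ i i' : Fin n', star ((((sqrtAbs (signVec (cmPlaceOver L) (cmGramEntry L e₁ dV hdV (lineW L (TW (↥(maximalRealSubfield L)) a))
          (complexConj_lineW L (TW (↥(maximalRealSubfield L)) a))) (imagUnit L) v₀) i : ℝ) : ℂ)) *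
        Matrix.reindex e₁ e₁
          ((((u : UnitaryGroup.archLocal L 2 (Matrix.diagonal dV) (cmPlaceOver L v₀)) : GL (Fin 2) ℂ) : Matrix (Fin 2) (Fin 2) ℂ) ⊗ₖ
            (1 : Matrix (Fin 1) (Fin 1) ℂ)) i i' *
        (((sqrtAbs (signVec (cmPlaceOver L) (cmGramEntry L e₁ dV hdV (lineW L (TW (↥(maximalRealSubfield L)) a))
          (complexConj_lineW L (TW (↥(maximalRealSubfield L)) a))) (imagUnit L) v₀) i' : ℝ) : ℂ))⁻¹) = (A : Matrix (Fin n') (Fin n') ℂ) i i')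
    (hβII : ∀ (W : Matrix.unitaryGroup (Fin n') ℂ) (β : (Fin n' × {v : InfinitePlace (↥(maximalRealSubfield L)) // v.IsReal}) →₀ ℕ),
      carrierConjEquiv (frameD L e₁ dV hdV hdV0 (lineW L (TW (↥(maximalRealSubfield L)) a)) (complexConj_lineW L (TW (↥(maximalRealSubfield L)) a))
          (lineW_ne_zero L (TW (↥(maximalRealSubfield L)) a) (isUnit_det_TW (↥(maximalRealSubfield L)) a)))
        (unitaryEquivPi (placeBlock (Pi.mulSingle v₀ (reindexUnitary (e₂ (n := n')).symm (blockU (W, 1))))))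
        (schwartzReindexCLM (↥(maximalRealSubfield L)) (e₂ (n := n'))
          (archBoxTensor (follandHermite (frameV L e₁ dV hdV hdV0 (lineW L (TW (↥(maximalRealSubfield L)) a))
              (complexConj_lineW L (TW (↥(maximalRealSubfield L)) a)) (lineW_ne_zero L (TW (↥(maximalRealSubfield L)) a) (isUnit_det_TW (↥(maximalRealSubfield L)) a))) β)
            (gaussianV L e₁ dV hdV hdV0 (lineW L (TW (↥(maximalRealSubfield L)) a)) (complexConj_lineW L (TW (↥(maximalRealSubfield L)) a))
              (lineW_ne_zero L (TW (↥(maximalRealSubfield L)) a) (isUnit_det_TW (↥(maximalRealSubfield L)) a))))) =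
      schwartzReindexCLM (↥(maximalRealSubfield L)) (e₂ (n := n'))
        (archBoxTensor
          (carrierConjEquiv (frameV L e₁ dV hdV hdV0 (lineW L (TW (↥(maximalRealSubfield L)) a)) (complexConj_lineW L (TW (↥(maximalRealSubfield L)) a))
              (lineW_ne_zero L (TW (↥(maximalRealSubfield L)) a) (isUnit_det_TW (↥(maximalRealSubfield L)) a)))
            (unitaryEquivPi (placeBlock (Pi.mulSingle v₀ W)))
            (follandHermite (frameV L e₁ dV hdV hdV0 (lineW L (TW (↥(maximalRealSubfield L)) a))
              (complexConj_lineW L (TW (↥(maximalRealSubfield L)) a)) (lineW_ne_zero L (TW (↥(maximalRealSubfield L)) a) (isUnit_det_TW (↥(maximalRealSubfield L)) a))) β))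
          (gaussianV L e₁ dV hdV hdV0 (lineW L (TW (↥(maximalRealSubfield L)) a)) (complexConj_lineW L (TW (↥(maximalRealSubfield L)) a))
            (lineW_ne_zero L (TW (↥(maximalRealSubfield L)) a) (isUnit_det_TW (↥(maximalRealSubfield L)) a)))))
    (φ : 𝓢((Fin n' → mixedEmbedding.mixedSpace ↥(maximalRealSubfield L)), ℂ)) (Φf : FinSB (↥(maximalRealSubfield L)) (Fin n')) :
    P.space.toSubmodule.starProjection
        (MemLp.toLp _ (F0LD1ThetaTransportKit.memLp_toQuotFun_lineThetaLift L 2 H e₁ dV hdV hdV0 ιA hιA μ hμ a hρ μW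
          (piSchwartzBruhatEquiv (↥(maximalRealSubfield L)) (Fin n') (φ ⊗ₜ Φf)) f μA 2)) = 0 := by
  haveI : Nontrivial (Fin n') := by
    have h3 : Fintype.card (Fin n') = 2 := by
      rw [← Fintype.card_congr e₁, Fintype.card_prod, Fintype.card_fin, Fintype.card_fin]
    rw [Fintype.card_fin] at h3
    subst h3
    infer_instance
  obtain ⟨Tθ, hTθ⟩ := F0LD2ThetaTensorCLM.exists_clm_comp_toLp_lineThetaLift_tmul L 2 H e₁ dV hdV hdV0 ιA hιA μ hμ a hρ μW f μA
    P.space.toSubmodule.starProjection Φf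
  set eV := frameV L e₁ dV hdV hdV0 (lineW L (TW (↥(maximalRealSubfield L)) a)) (complexConj_lineW L (TW (↥(maximalRealSubfield L)) a))
    (lineW_ne_zero L (TW (↥(maximalRealSubfield L)) a) (isUnit_det_TW (↥(maximalRealSubfield L)) a)) with heV
  let T' : SchwartzMap ((Fin n' × {v : InfinitePlace (↥(maximalRealSubfield L)) // v.IsReal}) → ℝ) ℂ →L[ℂ] Lp ℂ 2 μA :=
    Tθ.comp ((schwartzTransport eV).symm : _ ≃L[ℂ] _).toContinuousLinearMap
  have hT'apply : ∀ ψ, T' ψ = Tθ ((schwartzTransport eV).symm ψ) := fun ψ => rfl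
  have hne : piSchwartzBruhatEquiv (↥(maximalRealSubfield L)) (Fin n')
      (gaussianV L e₁ dV hdV hdV0 (lineW L (TW (↥(maximalRealSubfield L)) a)) (complexConj_lineW L (TW (↥(maximalRealSubfield L)) a))
        (lineW_ne_zero L (TW (↥(maximalRealSubfield L)) a) (isUnit_det_TW (↥(maximalRealSubfield L)) a)) ⊗ₜ Φf) ≠ 0 ∨ Φf = 0 := by
    by_cases hf : Φf = 0
    · exact Or.inr hf
    · exact Or.inl (piSchwartzBruhatEquiv_tmul_ne_zero (gaussianV_ne_zero L e₁ dV hdV hdV0 _ _ _) hf)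
  rcases hne with hne | hf
  swap
  · -- `Φ_f = 0`: the class is the class of `0`
    subst hf
    rw [TensorProduct.tmul_zero, map_zero, ← zero_smul ℂ (0 : piSchwartzBruhat (↥(maximalRealSubfield L)) (Fin n')),
      F0LD2ThetaTensorClasses.toLp_lineThetaLift_smul_left L 2 H e₁ dV hdV hdV0 ιA hιA μ hμ a hρ μW f μA, zero_smul, map_zero]
  have hcov : ∀ (A : Matrix.unitaryGroup (Fin n') ℂ) (β : (Fin n' × {v : InfinitePlace (↥(maximalRealSubfield L)) // v.IsReal}) →₀ ℕ),
      T' (unitaryOpPi (placeBlock (Pi.mulSingle v₀ A)) (hermitePi β)) =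
        ((A : Matrix (Fin n') (Fin n') ℂ).det ^ ((τ (cmPlaceOver L v₀).1 + 1) / 2)) • T' (hermitePi β) := by
    intro A β
    obtain ⟨u, hu⟩ := hS1 A
    obtain ⟨W, hW, hsec⟩ := exists_sectionD_archKPlace_apply_of_pos L e₁ dV hdV hdV0 (lineW L (TW (↥(maximalRealSubfield L)) a))
      (complexConj_lineW L (TW (↥(maximalRealSubfield L)) a)) (lineW_ne_zero L (TW (↥(maximalRealSubfield L)) a) (isUnit_det_TW (↥(maximalRealSubfield L)) a))
      v₀ u hpos
    have hWA : W = A := Subtype.ext (Matrix.ext fun i i' => (hW i i').trans (hu i i'))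
    subst hWA
    have hS := hβII W β
    have hbox : carrierConjEquiv (frameD L e₁ dV hdV hdV0 (lineW L (TW (↥(maximalRealSubfield L)) a)) (complexConj_lineW L (TW (↥(maximalRealSubfield L)) a))
          (lineW_ne_zero L (TW (↥(maximalRealSubfield L)) a) (isUnit_det_TW (↥(maximalRealSubfield L)) a)))
        (sectionD L e₁ dV hdV hdV0 (lineW L (TW (↥(maximalRealSubfield L)) a)) (complexConj_lineW L (TW (↥(maximalRealSubfield L)) a))
          (lineW_ne_zero L (TW (↥(maximalRealSubfield L)) a) (isUnit_det_TW (↥(maximalRealSubfield L)) a))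
          (archKPlace L e₁ dV hdV (lineW L (TW (↥(maximalRealSubfield L)) a)) (complexConj_lineW L (TW (↥(maximalRealSubfield L)) a)) v₀ u)).1.2
          (schwartzReindexCLM (↥(maximalRealSubfield L)) (e₂ (n := n'))
            (archBoxTensor (follandHermite eV β)
              (gaussianV L e₁ dV hdV hdV0 (lineW L (TW (↥(maximalRealSubfield L)) a)) (complexConj_lineW L (TW (↥(maximalRealSubfield L)) a))
                (lineW_ne_zero L (TW (↥(maximalRealSubfield L)) a) (isUnit_det_TW (↥(maximalRealSubfield L)) a))))) =
        MpS.vac (sectionD L e₁ dV hdV hdV0 (lineW L (TW (↥(maximalRealSubfield L)) a)) (complexConj_lineW L (TW (↥(maximalRealSubfield L)) a))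
            (lineW_ne_zero L (TW (↥(maximalRealSubfield L)) a) (isUnit_det_TW (↥(maximalRealSubfield L)) a))
            (archKPlace L e₁ dV hdV (lineW L (TW (↥(maximalRealSubfield L)) a)) (complexConj_lineW L (TW (↥(maximalRealSubfield L)) a)) v₀ u)) •
          schwartzReindexCLM (↥(maximalRealSubfield L)) (e₂ (n := n'))
            (archBoxTensor (carrierConjEquiv eV (unitaryEquivPi (placeBlock (Pi.mulSingle v₀ W))) (follandHermite eV β))
              (gaussianV L e₁ dV hdV hdV0 (lineW L (TW (↥(maximalRealSubfield L)) a)) (complexConj_lineW L (TW (↥(maximalRealSubfield L)) a))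
                (lineW_ne_zero L (TW (↥(maximalRealSubfield L)) a) (isUnit_det_TW (↥(maximalRealSubfield L)) a)))) := by
      rw [heV, ← hS, carrierConjEquiv_apply, carrierConjEquiv_apply, hsec, map_smul, unitaryEquivPi_apply]
    have hvac : MpS.vac (sectionD L e₁ dV hdV hdV0 (lineW L (TW (↥(maximalRealSubfield L)) a)) (complexConj_lineW L (TW (↥(maximalRealSubfield L)) a))
        (lineW_ne_zero L (TW (↥(maximalRealSubfield L)) a) (isUnit_det_TW (↥(maximalRealSubfield L)) a))
        (archKPlace L e₁ dV hdV (lineW L (TW (↥(maximalRealSubfield L)) a)) (complexConj_lineW L (TW (↥(maximalRealSubfield L)) a)) v₀ u)) ≠ 0 :=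
      MpS.vac_ne_zero _
    have hcov₁ := starProjection_toLp_lineThetaLift_tmul_of_box_of_fixed L H e₁ dV hdV hdV0 t ht g hg ιA hιA hpin μ hμ a hρ μW f w₁ P hKc v₀ hw₀ hτ hodd Φf u
      hvac hbox hne
    rw [etaD_mul_vac_archKPlace_of_pos L e₁ dV hdV hdV0 _ _ _ v₀ τ u hpos, pow_one] at hcov₁
    have hdetW : ((W : Matrix.unitaryGroup (Fin n') ℂ) : Matrix (Fin n') (Fin n') ℂ).det =
        star (((u : UnitaryGroup.archLocal L 2 (Matrix.diagonal dV) (cmPlaceOver L v₀)) : GL (Fin 2) ℂ) : Matrix (Fin 2) (Fin 2) ℂ).det := by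
      rw [det_eq_star_pow_of_entries e₁ (W : Matrix (Fin n') (Fin n') ℂ)
        (sqrtAbs_signVec_ne_zero (IsCMField.complexConj_ne_one L) (cmPlaceOver_smul L) (complexConj_imagUnit L) (imagUnit_ne_zero L)
          (cmGramEntry_ne_zero L e₁ dV hdV _ _ hdV0 (lineW_ne_zero L (TW (↥(maximalRealSubfield L)) a) (isUnit_det_TW (↥(maximalRealSubfield L)) a))) v₀)
        _ hW, pow_one]
    have hinv : ((((u : UnitaryGroup.archLocal L 2 (Matrix.diagonal dV) (cmPlaceOver L v₀)) : GL (Fin 2) ℂ) : Matrix (Fin 2) (Fin 2) ℂ).det ^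
        ((τ (cmPlaceOver L v₀).1 + 1) / 2))⁻¹ = ((W : Matrix.unitaryGroup (Fin n') ℂ) : Matrix (Fin n') (Fin n') ℂ).det ^ ((τ (cmPlaceOver L v₀).1 + 1) / 2) := by
      rw [hdetW, ← inv_zpow]
      congr 1
      exact inv_eq_of_mul_eq_one_left (star_det_mul_det_eq_one_of_mem_archLocal L dV hdV0 (cmPlaceOver L v₀) u)
    rw [hinv] at hcov₁
    rw [hT'apply, hT'apply, hTθ, hTθ]
    have h1 : (schwartzTransport eV).symm (unitaryOpPi (placeBlock (Pi.mulSingle v₀ W)) (hermitePi β)) =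
        carrierConjEquiv eV (unitaryEquivPi (placeBlock (Pi.mulSingle v₀ W))) (follandHermite eV β) := by
      rw [carrierConjEquiv_apply, follandHermite, ContinuousLinearEquiv.apply_symm_apply, unitaryEquivPi_apply]
    have h2 : (schwartzTransport eV).symm (hermitePi β) = follandHermite eV β := rfl
    rw [h1, h2]
    exact hcov₁
  have hT'0 : T' = 0 := eq_zero_of_forall_unitaryOpPi_placeBlock_mulSingle_hermitePi v₀ T' hm hcov
  have hφ : Tθ φ = T' (schwartzTransport eV φ) := by rw [hT'apply, ContinuousLinearEquiv.symm_apply_apply]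
  rw [← hTθ, hφ, hT'0]
  rfl

include ht hg hpin hKc in
set_option maxHeartbeats 1600000 in -- (as ★ n = 3: the telescope of ★ α ∕ ★ T3 is large; the rewrites are cheap but numerous)
/-- **THE PROJECTED THETA FUNCTIONAL VANISHES ON PURE TENSORS WHEN THE ARCHIMEDEAN EXPONENT IS WRONG, pair form NEGATIVE at `v₀`** (the `hKc` twin of ★ `…_eq_zero_of_neg₂`, proof verbatim; trailing binders `(φ) (Φf)` here, ★ has `(Φf) (φ)`)
(`(1−τ_{w₀})/2 ≠ 0`; `W_u` carries no conjugate, `det W_u = det u`; modulo `hS1`, `hβII`).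
[cite: Liu2021, proof of Prop. 4.13 Case 1 (l. 2137–2141, p. 48); App. D Lem. D.2 (1)] [cite: KonnoKonno2007, Thm. 5.4, Lemma 5.2] [cite: Folland1989, Prop. (4.76)] -/
theorem starProjection_toLp_lineThetaLift_tmul_eq_zero_of_neg_of_fixed (hw₀ : cmPlaceOver L v₀ ≠ w₁)
    {τ : InfinitePlace L → ℤ} (hτ : (toHeckeCharacter L μ).HasUnitaryArchType τ 0) (hodd : ∀ w, Odd (τ w))
    (hneg : ∀ k : Fin n', ¬ 0 < signVec (cmPlaceOver L) (cmGramEntry L e₁ dV hdV (lineW L (TW (↥(maximalRealSubfield L)) a))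
      (complexConj_lineW L (TW (↥(maximalRealSubfield L)) a))) (imagUnit L) v₀ k)
    (hm : (1 - τ (cmPlaceOver L v₀).1) / 2 ≠ 0)
    (hS1 : ∀ A : Matrix.unitaryGroup (Fin n') ℂ, ∃ u : UnitaryGroup.archLocal L 2 (Matrix.diagonal dV) (cmPlaceOver L v₀),
      ∀ i i' : Fin n', (((sqrtAbs (signVec (cmPlaceOver L) (cmGramEntry L e₁ dV hdV (lineW L (TW (↥(maximalRealSubfield L)) a))
          (complexConj_lineW L (TW (↥(maximalRealSubfield L)) a))) (imagUnit L) v₀) i : ℝ) : ℂ)) *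
        Matrix.reindex e₁ e₁
          ((((u : UnitaryGroup.archLocal L 2 (Matrix.diagonal dV) (cmPlaceOver L v₀)) : GL (Fin 2) ℂ) : Matrix (Fin 2) (Fin 2) ℂ) ⊗ₖ
            (1 : Matrix (Fin 1) (Fin 1) ℂ)) i i' *
        (((sqrtAbs (signVec (cmPlaceOver L) (cmGramEntry L e₁ dV hdV (lineW L (TW (↥(maximalRealSubfield L)) a))
          (complexConj_lineW L (TW (↥(maximalRealSubfield L)) a))) (imagUnit L) v₀) i' : ℝ) : ℂ))⁻¹ = (A : Matrix (Fin n') (Fin n') ℂ) i i')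
    (hβII : ∀ (W : Matrix.unitaryGroup (Fin n') ℂ) (β : (Fin n' × {v : InfinitePlace (↥(maximalRealSubfield L)) // v.IsReal}) →₀ ℕ),
      carrierConjEquiv (frameD L e₁ dV hdV hdV0 (lineW L (TW (↥(maximalRealSubfield L)) a)) (complexConj_lineW L (TW (↥(maximalRealSubfield L)) a))
          (lineW_ne_zero L (TW (↥(maximalRealSubfield L)) a) (isUnit_det_TW (↥(maximalRealSubfield L)) a)))
        (unitaryEquivPi (placeBlock (Pi.mulSingle v₀ (reindexUnitary (e₂ (n := n')).symm (blockU (W, 1))))))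
        (schwartzReindexCLM (↥(maximalRealSubfield L)) (e₂ (n := n'))
          (archBoxTensor (follandHermite (frameV L e₁ dV hdV hdV0 (lineW L (TW (↥(maximalRealSubfield L)) a))
              (complexConj_lineW L (TW (↥(maximalRealSubfield L)) a)) (lineW_ne_zero L (TW (↥(maximalRealSubfield L)) a) (isUnit_det_TW (↥(maximalRealSubfield L)) a))) β)
            (gaussianV L e₁ dV hdV hdV0 (lineW L (TW (↥(maximalRealSubfield L)) a)) (complexConj_lineW L (TW (↥(maximalRealSubfield L)) a))
              (lineW_ne_zero L (TW (↥(maximalRealSubfield L)) a) (isUnit_det_TW (↥(maximalRealSubfield L)) a))))) =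
      schwartzReindexCLM (↥(maximalRealSubfield L)) (e₂ (n := n'))
        (archBoxTensor
          (carrierConjEquiv (frameV L e₁ dV hdV hdV0 (lineW L (TW (↥(maximalRealSubfield L)) a)) (complexConj_lineW L (TW (↥(maximalRealSubfield L)) a))
              (lineW_ne_zero L (TW (↥(maximalRealSubfield L)) a) (isUnit_det_TW (↥(maximalRealSubfield L)) a)))
            (unitaryEquivPi (placeBlock (Pi.mulSingle v₀ W)))
            (follandHermite (frameV L e₁ dV hdV hdV0 (lineW L (TW (↥(maximalRealSubfield L)) a))
              (complexConj_lineW L (TW (↥(maximalRealSubfield L)) a)) (lineW_ne_zero L (TW (↥(maximalRealSubfield L)) a) (isUnit_det_TW (↥(maximalRealSubfield L)) a))) β))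
          (gaussianV L e₁ dV hdV hdV0 (lineW L (TW (↥(maximalRealSubfield L)) a)) (complexConj_lineW L (TW (↥(maximalRealSubfield L)) a))
            (lineW_ne_zero L (TW (↥(maximalRealSubfield L)) a) (isUnit_det_TW (↥(maximalRealSubfield L)) a)))))
    (φ : 𝓢((Fin n' → mixedEmbedding.mixedSpace ↥(maximalRealSubfield L)), ℂ)) (Φf : FinSB (↥(maximalRealSubfield L)) (Fin n')) :
    P.space.toSubmodule.starProjection
        (MemLp.toLp _ (F0LD1ThetaTransportKit.memLp_toQuotFun_lineThetaLift L 2 H e₁ dV hdV hdV0 ιA hιA μ hμ a hρ μW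
          (piSchwartzBruhatEquiv (↥(maximalRealSubfield L)) (Fin n') (φ ⊗ₜ Φf)) f μA 2)) = 0 := by
  haveI : Nontrivial (Fin n') := by
    have h3 : Fintype.card (Fin n') = 2 := by
      rw [← Fintype.card_congr e₁, Fintype.card_prod, Fintype.card_fin, Fintype.card_fin]
    rw [Fintype.card_fin] at h3
    subst h3
    infer_instance
  obtain ⟨Tθ, hTθ⟩ := F0LD2ThetaTensorCLM.exists_clm_comp_toLp_lineThetaLift_tmul L 2 H e₁ dV hdV hdV0 ιA hιA μ hμ a hρ μW f μA
    P.space.toSubmodule.starProjection Φf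
  set eV := frameV L e₁ dV hdV hdV0 (lineW L (TW (↥(maximalRealSubfield L)) a)) (complexConj_lineW L (TW (↥(maximalRealSubfield L)) a))
    (lineW_ne_zero L (TW (↥(maximalRealSubfield L)) a) (isUnit_det_TW (↥(maximalRealSubfield L)) a)) with heV
  let T' : SchwartzMap ((Fin n' × {v : InfinitePlace (↥(maximalRealSubfield L)) // v.IsReal}) → ℝ) ℂ →L[ℂ] Lp ℂ 2 μA :=
    Tθ.comp ((schwartzTransport eV).symm : _ ≃L[ℂ] _).toContinuousLinearMap
  have hT'apply : ∀ ψ, T' ψ = Tθ ((schwartzTransport eV).symm ψ) := fun ψ => rfl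
  have hne : piSchwartzBruhatEquiv (↥(maximalRealSubfield L)) (Fin n')
      (gaussianV L e₁ dV hdV hdV0 (lineW L (TW (↥(maximalRealSubfield L)) a)) (complexConj_lineW L (TW (↥(maximalRealSubfield L)) a))
        (lineW_ne_zero L (TW (↥(maximalRealSubfield L)) a) (isUnit_det_TW (↥(maximalRealSubfield L)) a)) ⊗ₜ Φf) ≠ 0 ∨ Φf = 0 := by
    by_cases hf : Φf = 0
    · exact Or.inr hf
    · exact Or.inl (piSchwartzBruhatEquiv_tmul_ne_zero (gaussianV_ne_zero L e₁ dV hdV hdV0 _ _ _) hf)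
  rcases hne with hne | hf
  swap
  · -- `Φ_f = 0`: the class is the class of `0`
    subst hf
    rw [TensorProduct.tmul_zero, map_zero, ← zero_smul ℂ (0 : piSchwartzBruhat (↥(maximalRealSubfield L)) (Fin n')),
      F0LD2ThetaTensorClasses.toLp_lineThetaLift_smul_left L 2 H e₁ dV hdV hdV0 ιA hιA μ hμ a hρ μW f μA, zero_smul, map_zero]
  have hcov : ∀ (A : Matrix.unitaryGroup (Fin n') ℂ) (β : (Fin n' × {v : InfinitePlace (↥(maximalRealSubfield L)) // v.IsReal}) →₀ ℕ),
      T' (unitaryOpPi (placeBlock (Pi.mulSingle v₀ A)) (hermitePi β)) =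
        ((A : Matrix (Fin n') (Fin n') ℂ).det ^ ((1 - τ (cmPlaceOver L v₀).1) / 2)) • T' (hermitePi β) := by
    intro A β
    obtain ⟨u, hu⟩ := hS1 A
    obtain ⟨W, hW, hsec⟩ := exists_sectionD_archKPlace_apply_of_neg L e₁ dV hdV hdV0 (lineW L (TW (↥(maximalRealSubfield L)) a))
      (complexConj_lineW L (TW (↥(maximalRealSubfield L)) a)) (lineW_ne_zero L (TW (↥(maximalRealSubfield L)) a) (isUnit_det_TW (↥(maximalRealSubfield L)) a))
      v₀ u hneg
    have hWA : W = A := Subtype.ext (Matrix.ext fun i i' => (hW i i').trans (hu i i'))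
    subst hWA
    have hS := hβII W β
    have hbox : carrierConjEquiv (frameD L e₁ dV hdV hdV0 (lineW L (TW (↥(maximalRealSubfield L)) a)) (complexConj_lineW L (TW (↥(maximalRealSubfield L)) a))
          (lineW_ne_zero L (TW (↥(maximalRealSubfield L)) a) (isUnit_det_TW (↥(maximalRealSubfield L)) a)))
        (sectionD L e₁ dV hdV hdV0 (lineW L (TW (↥(maximalRealSubfield L)) a)) (complexConj_lineW L (TW (↥(maximalRealSubfield L)) a))
          (lineW_ne_zero L (TW (↥(maximalRealSubfield L)) a) (isUnit_det_TW (↥(maximalRealSubfield L)) a))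
          (archKPlace L e₁ dV hdV (lineW L (TW (↥(maximalRealSubfield L)) a)) (complexConj_lineW L (TW (↥(maximalRealSubfield L)) a)) v₀ u)).1.2
          (schwartzReindexCLM (↥(maximalRealSubfield L)) (e₂ (n := n'))
            (archBoxTensor (follandHermite eV β)
              (gaussianV L e₁ dV hdV hdV0 (lineW L (TW (↥(maximalRealSubfield L)) a)) (complexConj_lineW L (TW (↥(maximalRealSubfield L)) a))
                (lineW_ne_zero L (TW (↥(maximalRealSubfield L)) a) (isUnit_det_TW (↥(maximalRealSubfield L)) a))))) =
        MpS.vac (sectionD L e₁ dV hdV hdV0 (lineW L (TW (↥(maximalRealSubfield L)) a)) (complexConj_lineW L (TW (↥(maximalRealSubfield L)) a))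
            (lineW_ne_zero L (TW (↥(maximalRealSubfield L)) a) (isUnit_det_TW (↥(maximalRealSubfield L)) a))
            (archKPlace L e₁ dV hdV (lineW L (TW (↥(maximalRealSubfield L)) a)) (complexConj_lineW L (TW (↥(maximalRealSubfield L)) a)) v₀ u)) •
          schwartzReindexCLM (↥(maximalRealSubfield L)) (e₂ (n := n'))
            (archBoxTensor (carrierConjEquiv eV (unitaryEquivPi (placeBlock (Pi.mulSingle v₀ W))) (follandHermite eV β))
              (gaussianV L e₁ dV hdV hdV0 (lineW L (TW (↥(maximalRealSubfield L)) a)) (complexConj_lineW L (TW (↥(maximalRealSubfield L)) a))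
                (lineW_ne_zero L (TW (↥(maximalRealSubfield L)) a) (isUnit_det_TW (↥(maximalRealSubfield L)) a)))) := by
      rw [heV, ← hS, carrierConjEquiv_apply, carrierConjEquiv_apply, hsec, map_smul, unitaryEquivPi_apply]
    have hvac : MpS.vac (sectionD L e₁ dV hdV hdV0 (lineW L (TW (↥(maximalRealSubfield L)) a)) (complexConj_lineW L (TW (↥(maximalRealSubfield L)) a))
        (lineW_ne_zero L (TW (↥(maximalRealSubfield L)) a) (isUnit_det_TW (↥(maximalRealSubfield L)) a))
        (archKPlace L e₁ dV hdV (lineW L (TW (↥(maximalRealSubfield L)) a)) (complexConj_lineW L (TW (↥(maximalRealSubfield L)) a)) v₀ u)) ≠ 0 :=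
      MpS.vac_ne_zero _
    have hcov₁ := starProjection_toLp_lineThetaLift_tmul_of_box_of_fixed L H e₁ dV hdV hdV0 t ht g hg ιA hιA hpin μ hμ a hρ μW f w₁ P hKc v₀ hw₀ hτ hodd Φf u
      hvac hbox hne
    rw [etaD_mul_vac_archKPlace_of_neg L e₁ dV hdV hdV0 _ _ _ v₀ hodd u hneg, pow_one] at hcov₁
    have hdetW : ((W : Matrix.unitaryGroup (Fin n') ℂ) : Matrix (Fin n') (Fin n') ℂ).det =
        (((u : UnitaryGroup.archLocal L 2 (Matrix.diagonal dV) (cmPlaceOver L v₀)) : GL (Fin 2) ℂ) : Matrix (Fin 2) (Fin 2) ℂ).det := by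
      rw [det_eq_pow_of_entries e₁ (W : Matrix (Fin n') (Fin n') ℂ)
        (sqrtAbs_signVec_ne_zero (IsCMField.complexConj_ne_one L) (cmPlaceOver_smul L) (complexConj_imagUnit L) (imagUnit_ne_zero L)
          (cmGramEntry_ne_zero L e₁ dV hdV _ _ hdV0 (lineW_ne_zero L (TW (↥(maximalRealSubfield L)) a) (isUnit_det_TW (↥(maximalRealSubfield L)) a))) v₀)
        _ hW, pow_one]
    have hdet0 : (((u : UnitaryGroup.archLocal L 2 (Matrix.diagonal dV) (cmPlaceOver L v₀)) : GL (Fin 2) ℂ) : Matrix (Fin 2) (Fin 2) ℂ).det ≠ 0 :=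
      (((u : UnitaryGroup.archLocal L 2 (Matrix.diagonal dV) (cmPlaceOver L v₀)) : GL (Fin 2) ℂ).isUnit.map Matrix.detMonoidHom).ne_zero
    have hinv : ((((u : UnitaryGroup.archLocal L 2 (Matrix.diagonal dV) (cmPlaceOver L v₀)) : GL (Fin 2) ℂ) : Matrix (Fin 2) (Fin 2) ℂ).det ^
        ((τ (cmPlaceOver L v₀).1 - 1) / 2))⁻¹ = ((W : Matrix.unitaryGroup (Fin n') ℂ) : Matrix (Fin n') (Fin n') ℂ).det ^ ((1 - τ (cmPlaceOver L v₀).1) / 2) := by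
      rw [hdetW, ← zpow_neg]
      congr 1
      obtain ⟨m, hm'⟩ := hodd (cmPlaceOver L v₀).1
      omega
    rw [hinv] at hcov₁
    rw [hT'apply, hT'apply, hTθ, hTθ]
    have h1 : (schwartzTransport eV).symm (unitaryOpPi (placeBlock (Pi.mulSingle v₀ W)) (hermitePi β)) =
        carrierConjEquiv eV (unitaryEquivPi (placeBlock (Pi.mulSingle v₀ W))) (follandHermite eV β) := by
      rw [carrierConjEquiv_apply, follandHermite, ContinuousLinearEquiv.apply_symm_apply, unitaryEquivPi_apply]
    have h2 : (schwartzTransport eV).symm (hermitePi β) = follandHermite eV β := rfl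
    rw [h1, h2]
    exact hcov₁
  have hT'0 : T' = 0 := eq_zero_of_forall_unitaryOpPi_placeBlock_mulSingle_hermitePi v₀ T' hm hcov
  have hφ : Tθ φ = T' (schwartzTransport eV φ) := by rw [hT'apply, ContinuousLinearEquiv.symm_apply_apply]
  rw [← hTθ, hφ, hT'0]
  rfl

end Core

end Summit.HodgeConjecture.HodgeConjecture.Cruxes.HLiu418.F0LD1ArchTypeAwayCoreOfInvariant

end
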